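import Summits.Ventures.YMGap.Census.KinkModel
import HarnessLib
import HarnessLib.Audit.Tags

/-!
# Venture YMGap — Conjectures/KinkIdentity.lean: the KINK IDENTITY for the one-character top moment, TYPED

HONEST FRAMING: venture file of the cell `pub-ymgap` (QuantumFields programme), seat engine-1 (g14).  TYPES, as an
`@[conjecture] def … : Prop` over the objects of `Census/KinkModel` and `Census/TwistCensusObjects`, the statement
  `∫ ∏_{p ∈ Λ₂} tr U_p dU = kinkSum Ls`   for every 3-torus `Π_i ℤ/(Ls i)`,
i.e. that the one-character top Haar moment of the whole torus equals the integer kink vertex sum divided by `864^{#sites}`.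
STATUS: a finite identity with a complete PAPER proof (cell file `HOME/engine/census/LadderSkew/AllOdd/kink/KINK-MODEL.md` §2:
`U(2)` Weingarten formula on every link — each link is degree-balanced — pairing labels planar/corner at the two link ENDS, site
weights `2^{#index cycles} > 0`, link matrix `[[1/3, −1/6], [−1/6, 1/3]]` diagonalised by the Hadamard basis) and verified against
every exact top moment of record (I(1,1,n), I(2,1,n), I(2,2,n), I(3,3,1); the slab spectra of 2×2, 3×2, 3×3, 3×4 (two machines),
4×4; cross-identities such as I(3,4,4) = I(4,4,3) to 10 digits); it is tagged `conjecture` ONLY because its Lean proof is not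
written — the ingredients are in the tree (`Census/SU2QuarticMoment`: the quaternion fourth moment; `Census/SU2DecoratedMerging`,
`Census/RectTimeSlicing`: merging / slicing inductions).  Why it matters: with it every census top moment is a statement about
an explicit INTEGER transfer matrix (translation blocks included), so kernel-checked certificates on those matrices
(`Census/KernelCertSlab3x3Block…`) become end-to-end theorems, and `Conjectures.TwistCensusParity` (C-1), already reduced to
«`0 < rectCharMoment Ls univ` on all-odd tori with every side ≥ 3», becomes a sign statement about `kinkSumInt`.
Not imported here: `Conjectures.TwistCensusParity` (keeps its status).  Nothing about the Wilson action, limits or a mass gap.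
-/

namespace Summit.Ventures.YMGap.Conjectures

open Summit.Ventures.YMGap.Census

/-- **THE KINK IDENTITY (typed; paper-proved, Lean proof pending).**  For every 3-torus with positive sides, the
one-character top Haar moment of the full plaquette set equals the kink sum of `Census/KinkModel`:
`rectCharMoment Ls univ = kinkSumInt Ls / 864^{#sites}`. -/
@[conjecture] def KinkIdentity : Prop :=
  ∀ (Ls : Fin 3 → ℕ) [∀ i, NeZero (Ls i)],
    rectCharMoment Ls (Finset.univ : Finset (RectPlaquette Ls)) = KinkModel.kinkSum Ls

/-- Unfolding: under the kink identity the sign of the top moment of a torus is the sign of the INTEGER `kinkSumInt Ls`. -/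
theorem rectCharMoment_pos_iff_of_kinkIdentity (h : KinkIdentity) (Ls : Fin 3 → ℕ) [∀ i, NeZero (Ls i)] :
    0 < rectCharMoment Ls (Finset.univ : Finset (RectPlaquette Ls)) ↔ 0 < KinkModel.kinkSumInt Ls := by
  rw [h Ls, KinkModel.kinkSum]
  have hpos : (0 : ℝ) < (864 : ℝ) ^ Fintype.card (Literature.MathematicalPhysics.QuantumLattice.RectTorusSite Ls) := by
    positivity
  rw [div_pos_iff_of_pos_right hpos]
  exact_mod_cast Iff.rfl

end Summit.Ventures.YMGap.Conjectures
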